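import Literature.AnabelianGeometry.EtaleTheta.SettingModelTateTheta
import Literature.AnabelianGeometry.EtaleTheta.SettingModelTateEllCoordinates
import Literature.AnabelianGeometry.EtaleTheta.ThetaSettingOriginClauses
import Literature.AnabelianGeometry.EtaleTheta.Discharge.Sec1Thm16GKNTate
import Literature.AnabelianGeometry.EtaleTheta.SettingModelCyclotomicCharacter
import Literature.AnabelianGeometry.EtaleTheta.Discharge.Sec1KerToZOfCompactNormalClosure
import HarnessLib

/-!
# `IsTateOrigin` HOLDS at the stage-2 («Tate shear») model `ThetaSetting.modelχq p i 2 even_two`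

abc-iut cell, layer L2, R78 cluster STAGE 2 (integrator abc-iut-L6-d6), seat abc-iut-w5-d051 (gen 3; author of the
clause text TM of abc-iut-L2-t6's `ThetaSetting.IsTateOrigin`, `ThetaSettingOriginClauses.lean`). Mochizuki, *The
étale theta function …*, Publ. RIMS **45** (2009) [EtTh], §1 p. 13 [cite: MochizukiEtTh2009, §1 p.13]:
«`(Δ^tp_Y)^ell ≅ Ẑ(1)`», «`1 → (Δ^tp_Y)^ell ⊗ ℤ/Nℤ → Gal(Y_N/Y) → Gal(K_N/K) → 1`», «`G_{K_N}` acts trivially on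
`(Δ^tp_X)^ell/N·(Δ^tp_Y)^ell`», `K_N = K(ζ_N, q_X^{1/N})`.

The print-faithful Tate-module clause FOR EVERY `N` FAILS at every earlier model of the cell — at the discrete root
model and at the χ-twisted model `modelχ` (`SettingModelOriginProfile.model_not_isTateOrigin`,
`SettingModelChiOriginProfile.modelχ_not_isTateOrigin`: with an untwisted `a`-axis the Kummer class of `q_X` would
have to be a coboundary). At abc-iut-L2-t5's STAGE-2 record `ThetaSetting.modelχq p i j` (F5q, over abc-iut-w5-d249's
carrier `Γ ⋊_{(κ_p^i, κ_p^j, χ)} G_{ℚ_p}`: `a ↦ Inn(b^{κ_p^i})(a·b^{κ_p^j})`, `b ↦ b^χ`) with the designated shear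
exponent `j = 2` (abc-iut-L2-t12: `[k] = 2κ(q̈) = κ(q_X)`, `q_X = p²`) it HOLDS:

* `toEll_inl_mem_ellPowersY` — the `N`-th POWER CRITERION in the coordinates `(ê, ê_b)` of
  `SettingModelTateEllCoordinates`: `ê(pr₁ q) = 1 ∧ ê_b(pr₁ q) ≡ 0 (N) ⇒ (inl q)^ell ∈ N·(Δ^tp_Y)^ell`
  («`Ker(Ẑ → ℤ/N) = Ẑ^N`», `ZHatLevel.level_eq_one_iff_exists_pow`);
* `exists_coords_of_mem_ellPowersY` — conversely every element of `N·(Δ^tp_Y)^ell` is `(inl q)^ell` with `ê = 1`,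
  `ê_b ≡ 0 (N)` (closure induction);
* **`modelχq_isTateOrigin`** — `(ThetaSetting.modelχq p i 2 even_two).IsTateOrigin` for every `i`, with, at level `N`:
  `y₁ = inl b`, `z = inl(η a, 1)`, `ζ = ζ_N` (abc-iut-L2-t5's chosen generator `cycGen`), `r = (p^{1/N})²`:
  (a)/(a′) from the power criterion, (b) from `ê_b(σ·q) = χ(σ) ê_b(q)` on `Δ^tp_Y` and `χ_N(σ) = k` when
  `σ ζ_N = ζ_N^k` (abc-iut-w5-d091's `levelChar_chi_eq_of_isPrimitiveRoot`), (c) from `ê_b(σ·(η a,1)) = κ_p(σ)²` and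
  «`σ (p^{1/N})² = ζ_N^m (p^{1/N})² ⇒ m ≡ 2κ_p(σ)`» — the Kummer class of `q_X` IS the corner cocycle of the shear;
* `ThetaSetting.exists_isEtThOrigin_and_isTateOrigin` — root + guard + the full Tate-module clause are jointly
  satisfiable (first model of the cell);
* §4 the ORIGIN PROFILE of the stage-2 model (`modelχq_origin_profile`): R1 ✓ (`kerToZIsCompactlyGenerated_modelχq`,
  compact generators as at the χ-model), R2 ✓ (vacuous), TM₂ ✓ (`modelχq_tate2`), `GKNIsKernelOfAction` ✓ (every `N`),
  and `IsThm16Origin` ✗ ONLY by the cusp clause (`curveχq` has no closed point; the cusped twin is abc-iut-w5-d029's F5qc).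

PROOF-ONLY (no definition, no named fact). Semi-synthetic model = consistency evidence only; nothing of [EtTh] is
asserted for genuine tempered fundamental groups; no side is taken on [IUTchIII] Cor. 3.12; typed ≠ proved.
-/

noncomputable section

namespace Literature.AnabelianGeometry.EtaleTheta.SettingModel

open Literature.AnabelianGeometry.SemiGraphs Thm16Sub Function Topology

section Model

variable (p : ℕ) [Fact p.Prime] (i : ℤ)

/-! ### 1. Record-level bookkeeping for `modelχq p i 2` -/

/-- The ell-quotient map of the stage-2 model is the quotient by `CurveTheta.ellKer (curveχq p i 2)`.
[cite: MochizukiEtTh2009, §1 p.12] -/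
theorem toEll_modelχq_apply (g : PiTpχq p i 2) :
    toEll (ThetaSetting.modelχq p i 2 even_two) g = QuotientGroup.mk' (CurveTheta.ellKer (curveχq p i 2)) g := by
  change ((CurveTheta.thetaToEll (curveχq p i 2)).comp (CurveTheta.toTheta (curveχq p i 2))) g = _
  rw [CurveTheta.thetaToEll_comp]

/-- Equality in `(Π^tp_X)^ell` of the stage-2 model. [cite: MochizukiEtTh2009, §1 p.12] -/
theorem toEll_modelχq_eq_iff (g h : PiTpχq p i 2) :
    toEll (ThetaSetting.modelχq p i 2 even_two) g = toEll (ThetaSetting.modelχq p i 2 even_two) h ↔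
      g⁻¹ * h ∈ CurveTheta.ellKer (curveχq p i 2) := by
  rw [toEll_modelχq_apply, toEll_modelχq_apply, QuotientGroup.mk'_apply, QuotientGroup.mk'_apply,
    QuotientGroup.eq]

/-- `Π^tp_X ↠ Z` of the stage-2 model is `pr₂ ∘ left`. [cite: MochizukiEtTh2009, §1 p.12] -/
theorem toZ_modelχq_apply (g : PiTpχq p i 2) : (ThetaSetting.modelχq p i 2 even_two).toZ g = gfpSnd g.left := rfl

/-- `inl q ∈ Δ^tp_Y` iff `pr₂ q = 0` (stage 2). [cite: MochizukiEtTh2009, §1 p.12] -/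
theorem inl_mem_dtpY_modelχq_iff (q : Gfp) :
    (SemidirectProduct.inl q : PiTpχq p i 2) ∈ (ThetaSetting.modelχq p i 2 even_two).DtpY ↔ gfpSnd q = 1 := by
  change (SemidirectProduct.inl q : PiTpχq p i 2) ∈
      (ThetaSetting.modelχq p i 2 even_two).toZ.ker ⊓ (curveχq p i 2).DeltaTemp ↔ _
  rw [Subgroup.mem_inf, MonoidHom.mem_ker, toZ_modelχq_apply, SemidirectProduct.left_inl,
    mem_deltaTempχq_iff, SemidirectProduct.right_inl]
  exact ⟨fun h => h.1, fun h => ⟨h, rfl⟩⟩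

/-- Elements of `Δ^tp_Y` of the stage-2 model: `right = 1`, `pr₂ left = 0`, `ê(pr₁ left) = 1`.
[cite: MochizukiEtTh2009, §1 p.12] -/
theorem right_eq_one_and_eHat_eq_one_of_mem_dtpYq {y : PiTpχq p i 2}
    (hy : y ∈ (ThetaSetting.modelχq p i 2 even_two).DtpY) :
    y.right = 1 ∧ gfpSnd y.left = 1 ∧ eHat (gfpFst y.left) = 1 := by
  obtain ⟨h1, h2⟩ := Subgroup.mem_inf.mp hy
  have hr : y.right = 1 := (mem_deltaTempχq_iff p i 2 y).mp h2
  have hs : gfpSnd y.left = 1 := by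
    change y ∈ ((tateTwistData₀ p i 2).toZ).ker at h1
    rwa [MonoidHom.mem_ker, GfpTwistData₀.toZ_apply] at h1
  exact ⟨hr, hs, eHat_gfpFst_eq_one hs⟩

/-- `inl(b^t) ∈ Δ^tp_Y` (stage 2). [cite: MochizukiEtTh2009, §1 p.12] -/
theorem inl_bPowGfp_mem_dtpYq (t : ZH) :
    (SemidirectProduct.inl (bPowGfp t) : PiTpχq p i 2) ∈ (ThetaSetting.modelχq p i 2 even_two).DtpY :=
  (inl_mem_dtpY_modelχq_iff p i _).mpr (gfpSnd_bPowGfp t)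

/-! ### 2. The `N`-th power criterion -/

/-- **POWER CRITERION.** If `ê(pr₁ q) = 1` and `ê_b(pr₁ q)` dies in `ℤ/N`, then `(inl q)^ell ∈ N·(Δ^tp_Y)^ell`:
`ê_b(pr₁ q) = t^N` in `Ẑ` («`Ker(Ẑ → ℤ/N) = Ẑ^N`») and `(inl q)^ell = ((inl b^t)^ell)^N`. [cite: MochizukiEtTh2009, §1 p.13] -/
theorem toEll_inl_mem_ellPowersY (N : ℕ+) {q : Gfp} (hx : eHat (gfpFst q) = 1)
    (hy : ZHatLevel.level N (eHatB (gfpFst q)) = 1) :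
    toEll (ThetaSetting.modelχq p i 2 even_two) (SemidirectProduct.inl q) ∈ ellPowersY (ThetaSetting.modelχq p i 2 even_two) N := by
  obtain ⟨t, ht⟩ := (ZHatLevel.level_eq_one_iff_exists_pow N _).mp hy
  set w : PiTpχq p i 2 := SemidirectProduct.inl (bPowGfp t) with hw
  have hwY : w ∈ (ThetaSetting.modelχq p i 2 even_two).DtpY := inl_bPowGfp_mem_dtpYq p i t
  have heq : toEll (ThetaSetting.modelχq p i 2 even_two) (SemidirectProduct.inl q) =
      toEll (ThetaSetting.modelχq p i 2 even_two) w ^ (N : ℕ) := by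
    rw [← map_pow, eq_comm, toEll_modelχq_eq_iff, hw, ← map_pow, ← map_inv, ← map_mul, inl_mem_ellKerχq_iff,
      map_mul, map_inv, map_pow, gfpFst_bPowGfp, map_mul, map_mul, map_inv, map_inv, map_pow, map_pow,
      eHat_bPow, eHatB_bPow, hx, ht, one_pow, inv_one, one_mul, inv_mul_cancel]
    exact ⟨rfl, rfl⟩
  rw [heq]
  exact Subgroup.subset_closure ⟨toEll (ThetaSetting.modelχq p i 2 even_two) w, ⟨w, hwY, rfl⟩, rfl⟩

/-- **Converse bookkeeping**: every element of `N·(Δ^tp_Y)^ell` is `(inl q)^ell` for some `q` with `pr₂ q = 0` and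
`ê_b(pr₁ q) ≡ 0 (N)` (closure induction: products and inverses of `N`-th powers of classes of `inl`'s).
[cite: MochizukiEtTh2009, §1 p.13] -/
theorem exists_coords_of_mem_ellPowersY (N : ℕ+) {e : (ThetaSetting.modelχq p i 2 even_two).GtpEll}
    (he : e ∈ ellPowersY (ThetaSetting.modelχq p i 2 even_two) N) :
    ∃ q : Gfp, gfpSnd q = 1 ∧ e = toEll (ThetaSetting.modelχq p i 2 even_two) (SemidirectProduct.inl q) ∧
      ZHatLevel.level N (eHatB (gfpFst q)) = 1 := by
  set D := ThetaSetting.modelχq p i 2 even_two with hD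
  refine Subgroup.closure_induction (p := fun e _ => ∃ q : Gfp, gfpSnd q = 1 ∧
      e = toEll D (SemidirectProduct.inl q) ∧ ZHatLevel.level N (eHatB (gfpFst q)) = 1) ?_ ?_ ?_ ?_ he
  · -- generators `ȳ^N`, `y ∈ Δ^tp_Y`
    rintro _ ⟨_, ⟨y, hy, rfl⟩, rfl⟩
    obtain ⟨hyr, hys, -⟩ := right_eq_one_and_eHat_eq_one_of_mem_dtpYq p i hy
    refine ⟨y.left ^ (N : ℕ), by rw [map_pow, hys, one_pow], ?_, ?_⟩
    · change toEll D y ^ (N : ℕ) = _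
      rw [← map_pow (toEll D)]
      congr 1
      conv_lhs => rw [eq_inl_of_right_eq_oneq p i 2 hyr]
      rw [← map_pow]
    · rw [map_pow, map_pow, ZHatLevel.level_pow_self]
  · exact ⟨1, map_one _, by rw [map_one, map_one], by rw [map_one, map_one, map_one]⟩
  · rintro e₁ e₂ - - ⟨q₁, hq₁, rfl, hl₁⟩ ⟨q₂, hq₂, rfl, hl₂⟩
    refine ⟨q₁ * q₂, by rw [map_mul, hq₁, hq₂, mul_one], by rw [← map_mul, ← map_mul], ?_⟩
    rw [map_mul, map_mul, map_mul, hl₁, hl₂, mul_one]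
  · rintro e - ⟨q, hq, rfl, hl⟩
    refine ⟨q⁻¹, by rw [map_inv, hq, inv_one], by rw [← map_inv, ← map_inv], ?_⟩
    rw [map_inv, map_inv, map_inv, hl, inv_one]

/-! ### 3. `IsTateOrigin` at the stage-2 model -/

/-- **`IsTateOrigin` HOLDS at the Tate-sheared model `ThetaSetting.modelχq p i 2 even_two`** (every inner exponent `i`; shear
exponent `j = 2 = κ(q_X)/κ(p)`): at each level `N`, `y₁ = inl b`, `z = inl(η a, 1)`, `ζ = ζ_N`, `r = (p^{1/N})²`.
[cite: MochizukiEtTh2009, §1 p.13] -/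
theorem modelχq_isTateOrigin : (ThetaSetting.modelχq p i 2 even_two).IsTateOrigin := by
  set D := ThetaSetting.modelχq p i 2 even_two with hD
  refine ⟨fun N => ?_⟩
  haveI : NeZero (N : ℕ) := ⟨N.ne_zero⟩
  -- the data
  let bG : Gfp := bPowGfp (iotaZ (Multiplicative.ofAdd 1))
  let aG : Gfp := ⟨(eta (FreeGroup.of 0), Multiplicative.ofAdd (1 : ℤ)), eta_a_mem_Gfpq⟩
  let y₁ : D.PiTemp := (SemidirectProduct.inl bG : PiTpχq p i 2)
  let z : D.PiTemp := (SemidirectProduct.inl aG : PiTpχq p i 2)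
  let ζ : PadicAlgCl p := (((cycGen p : ℕ+ → (PadicAlgCl p)ˣ) N : (PadicAlgCl p)ˣ) : PadicAlgCl p)
  let r : PadicAlgCl p := pRoot p N ^ 2
  have hζ : IsPrimitiveRoot ζ (N : ℕ) := isPrimitiveRoot_coe_cycGen p N
  have hbG_x : eHat (gfpFst bG) = 1 := by rw [gfpFst_bPowGfp, eHat_bPow]
  have hbG_y : eHatB (gfpFst bG) = iotaZ (Multiplicative.ofAdd 1) := by rw [gfpFst_bPowGfp, eHatB_bPow]
  have hy₁ : y₁ ∈ D.DtpY := inl_bPowGfp_mem_dtpYq p i _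
  have hz : z ∈ D.DeltaTemp := (mem_deltaTempχq_iff p i 2 _).mpr (SemidirectProduct.right_inl _)
  have hzZ : D.toZ z = Multiplicative.ofAdd 1 := by
    rw [toZ_modelχq_apply, SemidirectProduct.left_inl, gfpSnd_apply]
  -- the level-`N` character
  let lev : ZH →* Multiplicative (ZMod N) := ZHatLevel.level N
  have hlev : ∀ t : ZH, lev t = ZHatLevel.level N t := fun _ => rfl
  have hlev_one : lev (iotaZ (Multiplicative.ofAdd 1)) = Multiplicative.ofAdd 1 := by
    rw [hlev, iotaZ_one_eq, ZHatLevel.level_eta, Int.cast_one]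
  have hlev_bG : lev (eHatB (gfpFst bG)) = Multiplicative.ofAdd 1 := by rw [hbG_y]; exact hlev_one
  have hlev_aut : ∀ (φ : MulAut ZH) (t : ZH),
      Multiplicative.toAdd (lev (φ t)) = ZHatLevel.levelChar N φ * Multiplicative.toAdd (lev t) :=
    fun φ t => ZHatLevel.toAdd_level_aut N φ t
  refine ⟨y₁, z, ζ, r, hy₁, hz, hzZ, hζ, pRoot_sq_pow p N, ?_, ?_, ?_, ?_⟩
  · -- (a) generation: `y ≡ y₁^{ê_b(y) mod N}` modulo `N`-th powers
    intro y hy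
    obtain ⟨hyr, -, hyx⟩ := right_eq_one_and_eHat_eq_one_of_mem_dtpYq p i hy
    set v : ZMod N := Multiplicative.toAdd (lev (eHatB (gfpFst y.left))) with hv
    refine ⟨v.val, ?_⟩
    rw [← map_pow (toEll D), ← map_inv (toEll D), ← map_mul (toEll D), eq_inl_of_right_eq_oneq p i 2 hyr]
    change toEll D (SemidirectProduct.inl y.left * ((SemidirectProduct.inl bG : PiTpχq p i 2) ^ v.val)⁻¹) ∈ _
    rw [← map_pow (SemidirectProduct.inl : Gfp →* PiTpχq p i 2), ← map_inv (SemidirectProduct.inl : Gfp →* PiTpχq p i 2),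
      ← map_mul (SemidirectProduct.inl : Gfp →* PiTpχq p i 2)]
    refine toEll_inl_mem_ellPowersY p i N ?_ ?_
    · simp only [map_mul, map_inv, map_pow, hyx, hbG_x, one_pow, inv_one, mul_one]
    · show lev (eHatB (gfpFst (y.left * (bG ^ v.val)⁻¹))) = 1
      simp only [map_mul, map_inv, map_pow]
      rw [hlev_bG, ← ofAdd_nsmul, nsmul_eq_mul, mul_one, ZMod.natCast_zmod_val, hv, ofAdd_toAdd, mul_inv_cancel]
  · -- (a′) `ȳ₁^k ∈ N·(Δ^tp_Y)^ell ↔ N ∣ k`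
    intro k
    constructor
    · intro hk
      obtain ⟨q, -, hq, hl⟩ := exists_coords_of_mem_ellPowersY p i N hk
      rw [← map_pow (toEll D)] at hq
      change toEll D ((SemidirectProduct.inl bG : PiTpχq p i 2) ^ k) = _ at hq
      rw [← map_pow (SemidirectProduct.inl : Gfp →* PiTpχq p i 2), toEll_modelχq_eq_iff, ← map_inv, ← map_mul,
        inl_mem_ellKerχq_iff] at hq
      obtain ⟨-, hy⟩ := hq
      rw [map_mul, map_inv, map_pow, map_mul, map_inv, map_pow, hbG_y, inv_mul_eq_one] at hy
      -- `ê_b(q) = ι(1)^k`, so its level is `k mod N`, which is `0` by `hl`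
      have h1 : lev (iotaZ (Multiplicative.ofAdd 1) ^ k) = 1 := by rw [hy]; exact hl
      rw [map_pow, hlev_one, ← ofAdd_nsmul, nsmul_eq_mul, mul_one, ofAdd_eq_one, ZMod.natCast_eq_zero_iff] at h1
      exact h1
    · rintro ⟨m, rfl⟩
      rw [pow_mul', ← map_pow (toEll D)]
      exact Subgroup.subset_closure ⟨toEll D (y₁ ^ m), ⟨y₁ ^ m, D.DtpY.pow_mem hy₁ m, rfl⟩, rfl⟩
  · -- (b) Tate twist: `ê_b(σ·q) = χ(σ) ê_b(q)` on `Δ^tp_Y`, and `χ_N(σ) = k` when `σ ζ_N = ζ_N^k`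
    intro g k hk y hy
    have hχ : ZHatLevel.levelChar N (chi p g.right) = (k : ZMod N) :=
      levelChar_chi_eq_of_isPrimitiveRoot p g.right N hζ hk
    obtain ⟨hyr, hys, hyx⟩ := right_eq_one_and_eHat_eq_one_of_mem_dtpYq p i hy
    rw [← map_pow (toEll D), ← map_inv (toEll D), ← map_mul (toEll D), eq_inl_of_right_eq_oneq p i 2 hyr,
      conj_inl_eqq,
      ← map_pow (SemidirectProduct.inl : Gfp →* PiTpχq p i 2), ← map_inv (SemidirectProduct.inl : Gfp →* PiTpχq p i 2),
      ← map_mul (SemidirectProduct.inl : Gfp →* PiTpχq p i 2)]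
    refine toEll_inl_mem_ellPowersY p i N ?_ ?_
    · simp only [map_mul, map_inv, map_pow, eHat_gfpFst_actχq, hyx, one_pow, inv_one, mul_one, mul_inv_cancel]
    · show lev (eHatB (gfpFst (g.left * actχq p i 2 g.right y.left * g.left⁻¹ * (y.left ^ k)⁻¹))) = 1
      simp only [map_mul, map_inv, map_pow, eHatB_gfpFst_actχq_of_gfpSnd_eq_one p i 2 g.right hys]
      -- `Multiplicative (ℤ/N)` is commutative: cancel the conjugation, then compare levels
      rw [mul_inv_cancel_comm]
      apply Multiplicative.toAdd.injective
      rw [toAdd_mul, toAdd_inv, toAdd_pow, hlev_aut, hχ, toAdd_one, nsmul_eq_mul, add_neg_cancel]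
  · -- (c) Kummer class of `q_X = p²`: `ê_b(σ·(η a, 1)) = κ_p(σ)²` and `m ≡ 2κ_p(σ)`
    intro g m hm
    have haug : D.aug g = g.right := rfl
    rw [haug] at hm
    have hm2 : (m : ZMod N) = 2 * Multiplicative.toAdd (ZHatLevel.level N (kappaP p g.right)) :=
      natCast_eq_two_mul_of_apply_eq p g.right N hm
    have hEx : eHat (gfpFst (actχq p i 2 g.right aG)) = iotaZ (Multiplicative.ofAdd 1) :=
      eHat_gfpFst_actχq_eta_a p i 2 g.right
    have hEy : lev (eHatB (gfpFst (actχq p i 2 g.right aG))) = lev (kappaP p g.right) ^ (2 : ℤ) := by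
      rw [show eHatB (gfpFst (actχq p i 2 g.right aG)) = kappaP p g.right ^ (2 : ℤ) from
        eHatB_gfpFst_actχq_eta_a p i 2 g.right, map_zpow]
    have haG_x : eHat (gfpFst aG) = iotaZ (Multiplicative.ofAdd 1) := by
      rw [gfpFst_apply]
      change eHat (eta (FreeGroup.of 0)) = _
      rw [eHat_eta, expA_apply, heisHom_of_zero]
    have haG_y : eHatB (gfpFst aG) = 1 := by
      rw [gfpFst_apply]
      exact eHatB_eta_of_zero
    change toEll D (g * SemidirectProduct.inl aG * g⁻¹ * (SemidirectProduct.inl aG)⁻¹) *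
        (toEll D (SemidirectProduct.inl bG) ^ m)⁻¹ ∈ _
    rw [← map_pow (toEll D), ← map_inv (toEll D), ← map_mul (toEll D), conj_inl_eqq,
      ← map_inv (SemidirectProduct.inl : Gfp →* PiTpχq p i 2), ← map_mul (SemidirectProduct.inl : Gfp →* PiTpχq p i 2),
      ← map_pow (SemidirectProduct.inl : Gfp →* PiTpχq p i 2), ← map_inv (SemidirectProduct.inl : Gfp →* PiTpχq p i 2),
      ← map_mul (SemidirectProduct.inl : Gfp →* PiTpχq p i 2)]
    refine toEll_inl_mem_ellPowersY p i N ?_ ?_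
    · simp only [map_mul, map_inv, map_pow, hEx, haG_x, hbG_x, one_pow, inv_one, mul_one]
      rw [Literature.AnabelianGeometry.AbsoluteAnabelian.ZHatCompletion.mul_comm (eHat (gfpFst g.left))
        (iotaZ (Multiplicative.ofAdd 1))]
      group
    · show lev (eHatB (gfpFst (g.left * actχq p i 2 g.right aG * g.left⁻¹ * aG⁻¹ * (bG ^ m)⁻¹))) = 1
      simp only [map_mul, map_inv, map_pow, haG_y, inv_one, mul_one, hlev_bG, hEy]
      rw [mul_inv_cancel_comm]
      apply Multiplicative.toAdd.injective
      rw [toAdd_mul, toAdd_inv, toAdd_pow, toAdd_zpow, toAdd_ofAdd, toAdd_one, nsmul_eq_mul, mul_one, hm2,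
        zsmul_eq_mul, Int.cast_ofNat, hlev, add_neg_cancel]

/-- **«`G_{K_N} = Ker(G_K ↷ (Δ^tp_X)^ell / N·(Δ^tp_Y)^ell)`» at EVERY level `N`** at the Tate-sheared model
(abc-iut-L6-d5's `Thm16Sub.GKNIsKernelOfAction`), by this seat's `gknIsKernelOfAction_of_tate` (p420414).
[cite: MochizukiEtTh2009, §1 p.13] -/
theorem modelχq_gknIsKernelOfAction (N : ℕ+) : GKNIsKernelOfAction (ThetaSetting.modelχq p i 2 even_two) N := by
  obtain ⟨y₁, z, ζ, r, hy₁, hz, hzZ, hζ, hr, -, hord, htw, hkum⟩ := (modelχq_isTateOrigin p i).tate N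
  exact gknIsKernelOfAction_of_tate (ThetaSetting.modelχq p i 2 even_two) N hy₁ hz hzZ hζ hr hord htw hkum

/-- **Root + guard + the full Tate-module clause are jointly satisfiable** — witnessed by the Tate-sheared model
(at the discrete root model and at the χ-model `IsTateOrigin` is refuted). [cite: MochizukiEtTh2009, §1 p.13] -/
theorem _root_.Literature.AnabelianGeometry.EtaleTheta.ThetaSetting.exists_isEtThOrigin_and_isTateOrigin :
    ∃ D : ThetaSetting p, D.IsEtThOrigin ∧ D.IsTateOrigin :=
  ⟨ThetaSetting.modelχq p 0 2 even_two, ThetaSetting.modelχq_isEtThOrigin p 0 2 even_two, modelχq_isTateOrigin p 0⟩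


/-! ### 4. The origin profile of the stage-2 model: only the cusp clause of `IsThm16Origin` fails -/

/-- `curveχq` has no closed points, so no subgroup is a cuspidal decomposition group. [cite: MochizukiEtTh2009, §1 p.12] -/
theorem not_isCuspidalDecompositionGroup_modelχq (Dc : Subgroup (PiTpχq p i 2)) :
    ¬ (ThetaSetting.modelχq p i 2 even_two).IsCuspidalDecompositionGroup Dc := by
  rintro ⟨x, -, -⟩
  exact PEmpty.elim x

/-- **R2 holds at the stage-2 model, vacuously.** [cite: MochizukiEtTh2009, §1 p.13] -/
theorem modelχq_gtpYNFromCusp (N : ℕ+) : GtpYNFromCusp (ThetaSetting.modelχq p i 2 even_two) N :=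
  fun Dc hDc _ => (not_isCuspidalDecompositionGroup_modelχq p i Dc hDc).elim

/-- **The cusp clause of `IsThm16Origin` fails at the stage-2 model**, hence `IsThm16Origin` does.
[cite: MochizukiEtTh2009, §1 p.12] -/
theorem not_isThm16Origin_modelχq : ¬ (ThetaSetting.modelχq p i 2 even_two).IsThm16Origin := by
  rintro ⟨-, -, ⟨Dc, hDc, -⟩, -, -, -⟩
  exact not_isCuspidalDecompositionGroup_modelχq p i Dc hDc

/-- **R1 HOLDS at the stage-2 model**: `Π^tp_Y = inl(Ker pr₂)·inr(G_{ℚ_p})`, both compact (as at the χ-model,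
`SettingModelChiOriginProfile.kerToZIsCompactlyGenerated_modelχ`). [cite: MochizukiEtTh2009, §1 p.12] -/
theorem kerToZIsCompactlyGenerated_modelχq : KerToZIsCompactlyGenerated (ThetaSetting.modelχq p i 2 even_two) := by
  haveI := compactSpace_GQp p
  let K : Bool → Subgroup (PiTpχq p i 2) := fun b =>
    if b then (gfpSnd.ker).map (SemidirectProduct.inl : Gfp →* PiTpχq p i 2)
    else (⊤ : Subgroup (GQp p)).map (SemidirectProduct.inr : GQp p →* PiTpχq p i 2)
  have hKt : K true = (gfpSnd.ker).map (SemidirectProduct.inl : Gfp →* PiTpχq p i 2) := rfl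
  have hKf : K false = (⊤ : Subgroup (GQp p)).map (SemidirectProduct.inr : GQp p →* PiTpχq p i 2) := rfl
  refine ThetaSetting.kerToZIsCompactlyGenerated_of_le_normalClosure (ThetaSetting.modelχq p i 2 even_two) K ?_ ?_
  · intro b
    cases b
    · rw [hKf, Subgroup.coe_map, Subgroup.coe_top]
      exact isCompact_univ.image (continuous_inrχq p i 2)
    · rw [hKt, Subgroup.coe_map]
      exact isCompact_ker_gfpSnd.image (continuous_inlχq p i 2)
  · intro g hg
    change g ∈ ((tateTwistData₀ p i 2).toZ).ker at hg
    rw [MonoidHom.mem_ker, GfpTwistData₀.toZ_apply] at hg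
    refine Subgroup.le_topologicalClosure _ ?_
    rw [← SemidirectProduct.inl_left_mul_inr_right g]
    refine Subgroup.mul_mem _ (Subgroup.subset_normalClosure ?_) (Subgroup.subset_normalClosure ?_)
    · exact Set.mem_iUnion.mpr ⟨true, by rw [hKt]; exact ⟨g.left, hg, rfl⟩⟩
    · exact Set.mem_iUnion.mpr ⟨false, by rw [hKf]; exact ⟨g.right, Subgroup.mem_top _, rfl⟩⟩

/-- **TM₂ (`IsThm16Origin.tate2`) HOLDS at the stage-2 model** — the level-`2` instance of `IsTateOrigin`.
[cite: MochizukiEtTh2009, §1 p.13] -/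
theorem modelχq_tate2 :
    ∃ (y₁ z : (ThetaSetting.modelχq p i 2 even_two).PiTemp) (ζ r : PadicAlgCl p),
      y₁ ∈ (ThetaSetting.modelχq p i 2 even_two).DtpY ∧ z ∈ (ThetaSetting.modelχq p i 2 even_two).DeltaTemp ∧
      (ThetaSetting.modelχq p i 2 even_two).toZ z = Multiplicative.ofAdd 1 ∧
      IsPrimitiveRoot ζ ((2 : ℕ+) : ℕ) ∧ r ^ ((2 : ℕ+) : ℕ) = (ThetaSetting.modelχq p i 2 even_two).qX ∧
      (∀ y : (ThetaSetting.modelχq p i 2 even_two).PiTemp, y ∈ (ThetaSetting.modelχq p i 2 even_two).DtpY → ∃ k : ℕ,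
        toEll (ThetaSetting.modelχq p i 2 even_two) y * (toEll (ThetaSetting.modelχq p i 2 even_two) y₁ ^ k)⁻¹ ∈
          ellPowersY (ThetaSetting.modelχq p i 2 even_two) 2) ∧
      (∀ k : ℕ, toEll (ThetaSetting.modelχq p i 2 even_two) y₁ ^ k ∈ ellPowersY (ThetaSetting.modelχq p i 2 even_two) 2 ↔
        ((2 : ℕ+) : ℕ) ∣ k) ∧
      (∀ (g : (ThetaSetting.modelχq p i 2 even_two).PiTemp) (k : ℕ), (ThetaSetting.modelχq p i 2 even_two).aug g ζ = ζ ^ k →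
        ∀ y : (ThetaSetting.modelχq p i 2 even_two).PiTemp, y ∈ (ThetaSetting.modelχq p i 2 even_two).DtpY →
          toEll (ThetaSetting.modelχq p i 2 even_two) (g * y * g⁻¹) *
              (toEll (ThetaSetting.modelχq p i 2 even_two) y ^ k)⁻¹ ∈
            ellPowersY (ThetaSetting.modelχq p i 2 even_two) 2) ∧
      (∀ (g : (ThetaSetting.modelχq p i 2 even_two).PiTemp) (m : ℕ), (ThetaSetting.modelχq p i 2 even_two).aug g r = ζ ^ m * r →
        toEll (ThetaSetting.modelχq p i 2 even_two) (g * z * g⁻¹ * z⁻¹) *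
            (toEll (ThetaSetting.modelχq p i 2 even_two) y₁ ^ m)⁻¹ ∈
          ellPowersY (ThetaSetting.modelχq p i 2 even_two) 2) :=
  (modelχq_isTateOrigin p i).tate2

/-- **The origin profile of the stage-2 model**: guard ✓, R1 ✓, R2 ✓ (vacuous), TM (every `N`) ✓, `GKNIsKernelOfAction`
(every `N`) ✓ — and `IsThm16Origin` ✗ by the CUSP clause alone (no closed point on `curveχq`).
[cite: MochizukiEtTh2009, §1 p.12] -/
theorem modelχq_origin_profile :
    (ThetaSetting.modelχq p i 2 even_two).IsEtThOrigin ∧ KerToZIsCompactlyGenerated (ThetaSetting.modelχq p i 2 even_two) ∧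
      (∀ N : ℕ+, GtpYNFromCusp (ThetaSetting.modelχq p i 2 even_two) N) ∧
      (ThetaSetting.modelχq p i 2 even_two).IsTateOrigin ∧
      (∀ N : ℕ+, GKNIsKernelOfAction (ThetaSetting.modelχq p i 2 even_two) N) ∧
      ¬ (ThetaSetting.modelχq p i 2 even_two).IsThm16Origin :=
  ⟨ThetaSetting.modelχq_isEtThOrigin p i 2 even_two, kerToZIsCompactlyGenerated_modelχq p i,
    modelχq_gtpYNFromCusp p i, modelχq_isTateOrigin p i, modelχq_gknIsKernelOfAction p i,
    not_isThm16Origin_modelχq p i⟩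

end Model

end Literature.AnabelianGeometry.EtaleTheta.SettingModel

end
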